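import Summits.CriticalPhenomena.Ising3DConformalLimit.Theorems.GapForcesFarMerging.Negative.SoftFamilies
import Literature.Probability.LatticeModels.MessagerMiracleSole
import HarnessLib

/-!
# Objects of the line `rp-schwarz-single-pinch` for the crux `GapForcesFarMerging`
(item stmt-CriticalPhenomena-4468; route decl
`Summit.CriticalPhenomena.Ising3DConformalLimit.Theses.EnergyNotSigmaSquared.GapForcesFarMerging`)

Route-posited objects (D-0016: the definitions a line posits live in a reviewed `…Defs` file, never
inside a proof file; precedents `EnergyNotSigmaSquaredGapForcesFarMergingScreeningDefs.lean`,
`EnergyNotSigmaSquaredGapForcesFarMergingSandwichDefs.lean`). The line (checked skeleton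
`Cruxes/GapForcesFarMerging/Lines/rp-schwarz-single-pinch.lean`, planner
`planner-cruxplan-stmt-CriticalPhenomena-4468-rp-schwarz-single-pi-0`, lead seat c3
`prover-line-stmt-CriticalPhenomena-4468-c3-0`) un-pinches the FAR end of the energy gap by the `2 × 2`
Gram minor of reflection positivity across the lattice mirrors `x₀ ↦ t - x₀` (site planes for even `t`,
bond planes for odd `t`), reads the resulting one-pinch law on doubling-regular dyadic scales in
Aizenman's (cross-Wick) normalisation, and isolates the transfer to far merging along thin split-pinch
shapes as its one open step.

Contents (definitional bookkeeping only; the mathematics is in the stub files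
`Theorems/EnergyNotSigmaSquaredGapForcesFarMergingRPSchwarz*.lean` that import this module):
* `pairTrunc` (truncated pair–pair correlation of the critical state), `dy k = 2^k e₁`, the thin
  split-pinch shapes `thinShape m`;
* the currencies of the line (statements composed by the registered skeleton): `RPSchwarzOnePinch`
  (stub A), `OnePinchLaw` (conclusion of stub B), `OnePinchLawOnRegularScales` (conclusion of stub R),
  `DyadicSplitMerging` (conclusion of stub T);
* sanity lemmas: the thin shapes are injective, `DyadicSplitMerging` is a far-merging witness
  (`farMergingShape_of_dyadicSplitMerging`, infinite pigeonhole over the finite shape menu), and the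
  composition certificate `gapForcesFarMerging_of_onePinchLaw_transfer` (crux ⇐ B-conclusion ∧ R ∧ T).
The lattice vocabulary `e₁ = (1,0,0)`, `e₂ = (0,1,0)`, `cc2`, `FarMergingShape`, `crux_iff` is that of
`Theorems/GapForcesFarMerging/Negative/{SoftShapes,SoftFamilies}.lean` (imported, not restated; `injective_vec4`
from `SoftFamilies`), `axisRefl` that of
`Literature.Probability.LatticeModels.MessagerMiracleSole`.

References: Fröhlich–Israel–Lieb–Simon 1978 Thm 2.1 (reflection positivity, the Gram/Schwarz
inequality); Friedli–Velenik 2017 Lemma 10.8; Aizenman 1982 Prop. 5.3 (`U₄ = -2⟨σσ⟩⟨σσ⟩·P[merge]`);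
Aizenman–Duminil-Copin 2021 §3 (3.7), (3.11); Messager–Miracle-Solé 1977.
-/

noncomputable section

namespace Summit.CriticalPhenomena.Ising3DConformalLimit.GapForcesFarMergingRPSchwarz

open Literature.Probability.LatticeModels
open Summit.CriticalPhenomena.Ising3DConformalLimit.Theses.EnergyNotSigmaSquared
open Summit.CriticalPhenomena.Ising3DConformalLimit.Theorems.GapForcesFarMerging.Negative
  (e₁ e₂ cc2 FarMergingShape crux_iff injective_vec4)

/-! ### Lattice vocabulary -/

/-- The dyadic axis point `2^k e₁ = (2^k, 0, 0)` (the far plane of the `k`-th scale).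
(Route-posited notation of the line, not a literature fact.) -/
def dy (k : ℕ) : Site 3 := ((2 ^ k : ℕ) : ℤ) • e₁

/-- Truncated pair–pair correlation of the critical state on `ℤ³`:
`⟨σ_aσ_b ; σ_cσ_d⟩ := ⟨σ_aσ_bσ_cσ_d⟩_{β_c} − ⟨σ_aσ_b⟩_{β_c}⟨σ_cσ_d⟩_{β_c}` (`criticalCorr 3` = the unique
critical state; repetitions allowed, `σ² = 1`). With `(a,b) = (0,e₂)` and `(c,d) = (x, x+e₂)` this is the
left-hand side of `EnergyGapPowerLaw`; it is `pairCovS cc2 (criticalCorr 3 4)` of `Negative.LineShapes`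
(not imported here to keep the cone small). (Route-posited notation, not a literature fact.) -/
def pairTrunc (a b c d : Site 3) : ℝ :=
  criticalCorr 3 4 ![a, b, c, d] - criticalCorr 3 2 ![a, b] * criticalCorr 3 2 ![c, d]

/-- The THIN split-pinch shapes `X_m := (0, 2^m e₁ − 2^m e₂, e₂, 2^m e₁ + 2^m e₂)`, labelled
(source₁, target₁, source₂, target₂): dilated by `L` the sources `0, Le₂` are `L` apart, the targets
`(2^m L, ∓2^m L, 0)` sit on the far plane at distance `t = 2^m L`, and the `(x₀x₁)(x₂x₃)` pairing product of
`FarMerging` is `G(0, LY)·G(Le₂, LZ)`, Aizenman's normalisation of the merging probability of the parallel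
strands `0 → (t,−t,0)`, `Le₂ → (t,t,0)`. (Route-posited notation, not a literature fact.) -/
def thinShape (m : ℕ) : Fin 4 → Site 3 :=
  ![0, dy m - ((2 ^ m : ℕ) : ℤ) • e₂, e₂, dy m + ((2 ^ m : ℕ) : ℤ) • e₂]

/-! ### Currencies of the line (the statements composed by the registered skeleton) -/

/-- (A) `RPSchwarzOnePinch` — the `2 × 2` Gram minor of reflection positivity across the mirror
`θ_t := axisRefl 0 t : y ↦ (t − y₀, y₁, y₂)` (the plane `y₀ = t/2`: a bond plane for odd `t`, a site plane
for even `t`), rows `ε_b − ⟨ε_b⟩` (`b = {0,e₂}`, in the half `2y₀ ≤ t`) and `σ_pσ_q − ⟨σ_pσ_q⟩`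
(`2p₀ ≤ t`, `2q₀ ≤ t`):
`⟨σ₀σ_{e₂} ; σ_{θp}σ_{θq}⟩² ≤ ⟨σ₀σ_{e₂} ; σ_{te₁}σ_{te₁+e₂}⟩ · ⟨σ_pσ_q ; σ_{θp}σ_{θq}⟩`
(`θ0 = te₁`, `θe₂ = te₁ + e₂`: the diagonal energy entry is GAP's pattern at `x = te₁`). Statement of the
registered stub `stub_rpSchwarzOnePinch` (FILS78 Thm 2.1 for the critical state; route-posited currency of
the line, not a literature fact). -/
def RPSchwarzOnePinch : Prop :=
  ∀ t : ℕ, 1 ≤ t → ∀ p q : Site 3, 2 * p 0 ≤ (t : ℤ) → 2 * q 0 ≤ (t : ℤ) →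
    pairTrunc 0 e₂ (axisRefl 0 (t : ℤ) p) (axisRefl 0 (t : ℤ) q) ^ 2 ≤
      pairTrunc 0 e₂ ((t : ℤ) • e₁) ((t : ℤ) • e₁ + e₂) *
        pairTrunc p q (axisRefl 0 (t : ℤ) p) (axisRefl 0 (t : ℤ) q)

/-- (B) THE ONE-PINCH LAW (output of RP halving, RP normalisation): for some `κ' > 0` (`= κ/2`) and `C`,
for EVERY `t ≥ 1` and all pairs `p, q` in the plane `y₀ = 0`,
`⟨σ₀σ_{e₂} ; σ_{te₁+p}σ_{te₁+q}⟩ ≤ C t^{-κ'} G(te₁)²` — strands from the ADJACENT nails `0, e₂` to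
targets on the far plane `y₀ = t`, one pinch only. Conclusion of the registered stub
`stub_gapGivesOnePinchLaw : RPSchwarzOnePinch → EnergyGapPowerLaw → OnePinchLaw` (route-posited currency of
the line, not a literature fact). -/
def OnePinchLaw : Prop :=
  ∃ κ C : ℝ, 0 < κ ∧ ∀ t : ℕ, 1 ≤ t → ∀ p q : Site 3, p 0 = 0 → q 0 = 0 →
    pairTrunc 0 e₂ ((t : ℤ) • e₁ + p) ((t : ℤ) • e₁ + q) ≤
      C * (t : ℝ) ^ (-κ) * criticalTwoPoint 3 ((t : ℤ) • e₁) ^ 2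

/-- (R) THE ONE-PINCH LAW ON REGULAR SCALES (cross-Wick / Aizenman normalisation): `κ' > 0`, `C`,
`c₀ > 0` such that (i) `c₀`-doubling-regular dyadic scales `k` (`c₀ G(2^k e₁) ≤ G(2^{k+2} e₁)`) are
UNBOUNDED, and (ii) at every such scale, for all in-plane targets in the cone `‖p‖, ‖q‖ ≤ 2^k`
(sup norm), with `T = 2^k e₁`,
`⟨σ₀σ_{e₂} ; σ_{T+p}σ_{T+q}⟩ ≤ C (2^k)^{-κ'} (⟨σ₀σ_{T+p}⟩⟨σ_{e₂}σ_{T+q}⟩ + ⟨σ₀σ_{T+q}⟩⟨σ_{e₂}σ_{T+p}⟩)`.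
By `EnergyFactorisation` (item 4472, infinite volume: `energyFactorisation_criticalCorr`) the bracket splits
the left-hand side as `GG·A_par + GG·A_cross`, so (ii) says that BOTH single-pinch avoidance probabilities
of two independent sourced critical currents `0 → T+p`, `e₂ → T+q` are `≤ C (2^k)^{-κ'}`. Conclusion of the
registered stub `stub_regularReading : OnePinchLaw → OnePinchLawOnRegularScales` (route-posited currency
of the line, not a literature fact). -/
def OnePinchLawOnRegularScales : Prop :=
  ∃ κ C c₀ : ℝ, 0 < κ ∧ 0 < c₀ ∧
    (∀ k₀ : ℕ, ∃ k : ℕ, k₀ ≤ k ∧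
      c₀ * criticalTwoPoint 3 (dy k) ≤ criticalTwoPoint 3 (dy (k + 2))) ∧
    ∀ k : ℕ, c₀ * criticalTwoPoint 3 (dy k) ≤ criticalTwoPoint 3 (dy (k + 2)) →
      ∀ p q : Site 3, p 0 = 0 → q 0 = 0 → ‖p‖ ≤ ((2 ^ k : ℕ) : ℝ) → ‖q‖ ≤ ((2 ^ k : ℕ) : ℝ) →
        pairTrunc 0 e₂ (dy k + p) (dy k + q) ≤
          C * ((2 ^ k : ℕ) : ℝ) ^ (-κ) *
            (criticalCorr 3 2 ![0, dy k + p] * criticalCorr 3 2 ![e₂, dy k + q] +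
              criticalCorr 3 2 ![0, dy k + q] * criticalCorr 3 2 ![e₂, dy k + p])

/-- (T) DYADIC SPLIT-PINCH FAR MERGING (conclusion of the open transfer stub
`stub_onePinchForcesSplitMerging : OnePinchLaw → OnePinchLawOnRegularScales → DyadicSplitMerging`): `c > 0`
and a FINITE shape menu `m ≤ M` such that for unboundedly many dyadic dilations `L = 2^j` some `X_m` of the
menu has `U₄(L X_m) ≤ −c ⟨σ_{Lx₀}σ_{Lx₁}⟩⟨σ_{Lx₂}σ_{Lx₃}⟩` — verbatim the inequality of the crux's
consequent (`FarMergingShape cc2 (criticalCorr 3 4)`) at `x = X_m`, `L = 2^j`; by Aizenman's identity it says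
`P^{0,LY}⊗P^{Le₂,LZ}[0 ↔ Le₂] ≥ c/2`. (Route-posited currency of the line, not a literature fact.) -/
def DyadicSplitMerging : Prop :=
  ∃ c : ℝ, 0 < c ∧ ∃ M : ℕ, ∀ j₀ : ℕ, ∃ j : ℕ, j₀ ≤ j ∧ ∃ m : ℕ, m ≤ M ∧
    criticalCorr 3 4 (fun i => ((2 ^ j : ℕ) : ℤ) • thinShape m i) -
        (criticalCorr 3 2 ![((2 ^ j : ℕ) : ℤ) • thinShape m 0, ((2 ^ j : ℕ) : ℤ) • thinShape m 1] *
            criticalCorr 3 2 ![((2 ^ j : ℕ) : ℤ) • thinShape m 2, ((2 ^ j : ℕ) : ℤ) • thinShape m 3] +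
          criticalCorr 3 2 ![((2 ^ j : ℕ) : ℤ) • thinShape m 0, ((2 ^ j : ℕ) : ℤ) • thinShape m 2] *
            criticalCorr 3 2 ![((2 ^ j : ℕ) : ℤ) • thinShape m 1, ((2 ^ j : ℕ) : ℤ) • thinShape m 3] +
          criticalCorr 3 2 ![((2 ^ j : ℕ) : ℤ) • thinShape m 0, ((2 ^ j : ℕ) : ℤ) • thinShape m 3] *
            criticalCorr 3 2 ![((2 ^ j : ℕ) : ℤ) • thinShape m 1, ((2 ^ j : ℕ) : ℤ) • thinShape m 2])
      ≤ -(c * (criticalCorr 3 2 ![((2 ^ j : ℕ) : ℤ) • thinShape m 0, ((2 ^ j : ℕ) : ℤ) • thinShape m 1] *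
            criticalCorr 3 2 ![((2 ^ j : ℕ) : ℤ) • thinShape m 2, ((2 ^ j : ℕ) : ℤ) • thinShape m 3]))

/-! ### Sanity lemmas -/

/-- `pairTrunc` unfolded (definitional). [folklore] -/
theorem pairTrunc_def (a b c d : Site 3) :
    pairTrunc a b c d = criticalCorr 3 4 ![a, b, c, d] - cc2 a b * cc2 c d := rfl

/-- Infinite pigeonhole over a finite menu: if for unboundedly many `j` some index `m ≤ M` works,
then one fixed `m ≤ M` works for unboundedly many `j`. [folklore] -/
theorem exists_index_io {M : ℕ} {P : ℕ → ℕ → Prop}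
    (h : ∀ j₀ : ℕ, ∃ j : ℕ, j₀ ≤ j ∧ ∃ m : ℕ, m ≤ M ∧ P m j) :
    ∃ m : ℕ, m ≤ M ∧ ∀ j₀ : ℕ, ∃ j : ℕ, j₀ ≤ j ∧ P m j := by
  induction M with
  | zero =>
    refine ⟨0, le_rfl, fun j₀ => ?_⟩
    obtain ⟨j, hj, m, hm, hP⟩ := h j₀
    obtain rfl : m = 0 := Nat.le_zero.mp hm
    exact ⟨j, hj, hP⟩
  | succ M ih =>
    by_cases htop : ∀ j₀ : ℕ, ∃ j : ℕ, j₀ ≤ j ∧ P (M + 1) j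
    · exact ⟨M + 1, le_rfl, htop⟩
    · push Not at htop
      obtain ⟨j₁, hj₁⟩ := htop
      have h' : ∀ j₀ : ℕ, ∃ j : ℕ, j₀ ≤ j ∧ ∃ m : ℕ, m ≤ M ∧ P m j := by
        intro j₀
        obtain ⟨j, hj, m, hm, hP⟩ := h (max j₀ j₁)
        have hne : m ≠ M + 1 := by
          rintro rfl
          exact hj₁ j (le_trans (le_max_right _ _) hj) hP
        exact ⟨j, le_trans (le_max_left _ _) hj, m, by omega, hP⟩
      obtain ⟨m, hm, hio⟩ := ih h'
      exact ⟨m, by omega, hio⟩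

/-- The thin shapes are injective (all four lattice points distinct). [folklore] -/
theorem thinShape_injective (m : ℕ) : Function.Injective (thinShape m) := by
  have h2 : (0 : ℤ) < 2 ^ m := by positivity
  unfold thinShape dy
  refine injective_vec4 ?_ ?_ ?_ ?_ ?_ ?_
  · intro h; have := congrFun h 0; simp at this; linarith
  · intro h; have := congrFun h 1; simp at this
  · intro h; have := congrFun h 0; simp at this; linarith
  · intro h; have := congrFun h 0; simp at this
  · intro h; have := congrFun h 1; simp at this; linarith
  · intro h; have := congrFun h 0; simp at this; linarith

/-- `DyadicSplitMerging` is a far-merging witness: fix the shape by pigeonhole over the finite menu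
and dilate dyadically (`L = 2^j ≥ j ≥ L₀`). [folklore] -/
theorem farMergingShape_of_dyadicSplitMerging :
    DyadicSplitMerging → FarMergingShape cc2 (criticalCorr 3 4) := by
  rintro ⟨c, hc, M, hio⟩
  obtain ⟨m, -, hm⟩ := exists_index_io hio
  refine ⟨c, hc, thinShape m, thinShape_injective m, fun L₀ => ?_⟩
  obtain ⟨j, hj, hP⟩ := hm L₀
  exact ⟨2 ^ j, le_trans hj (Nat.lt_two_pow_self).le, hP⟩

/-- **Composition certificate of the line**: the crux BY NAME from the three statements the skeleton
chains after GAP — the one-pinch law (conclusion of stubs A+B fed with GAP), its regular reading (R) and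
the transfer (T). [folklore] -/
theorem gapForcesFarMerging_of_onePinchLaw_transfer :
    (EnergyGapPowerLaw → OnePinchLaw) → (OnePinchLaw → OnePinchLawOnRegularScales) →
      (OnePinchLaw → OnePinchLawOnRegularScales → DyadicSplitMerging) → GapForcesFarMerging :=
  fun hB hR hT => crux_iff.2 fun hgap =>
    have hO : OnePinchLaw := hB hgap
    farMergingShape_of_dyadicSplitMerging (hT hO (hR hO))

end Summit.CriticalPhenomena.Ising3DConformalLimit.GapForcesFarMergingRPSchwarz

end
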